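import Literature.NumberTheory.ComplexMultiplication.CyclicAsymmetricCMHalves
import Mathlib.GroupTheory.OrderOfElement
import Mathlib.Tactic.Ring
import Mathlib.Tactic.LinearCombination
import HarnessLib

/-!
# Semidihedral / modular type relations `ξ α = α^{h∓1} ξ`: the unit `u = h ∓ 1` of `ℤ/2h` and normal forms
# `αⁱ`, `αⁱ ξ` (group-theoretic preliminaries)

COR-CM (cell `pub-hodgecm2`), binder seat b04 (gen 22), count-neutral claim GALOIS-DIHEDRAL, part VIII-a — the
group-theoretic half of part VIII (`CorCM/GaloisSemidihedralModularDegenerateTypes`: the double interval is a primitive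
degenerate CM type for every Galois group of semidihedral or modular type of order `4h`, `h ≥ 4` even).  KERNEL ONLY:
theorems (Mathlib only); no definition, no named fact, no `sorry`.  `HC_CM` is neither used nor claimed.

SETTING.  A group `G` with `α, ξ ∈ G`, `ord α = 2h`, `ξ ∉ ⟨α⟩`, `ξ² = 1`, `|G| = 4h`, and `ξ α = α^{u₀} ξ` with
`u₀ = h − 1` (semidihedral type) or `u₀ = h + 1` (modular type).  Exponents are read in `ℤ/2h` through `val`.
* §1 (`h` even): in `ℤ/2h`, `h² = 0`, `−h = h`; `u = u₀` has an inverse and `u h = h`, so `u j = 0 ↔ j = 0` and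
  `u j = h ↔ j = h` (`mul_eq_zero_iff_and_mul_eq_h_iff`).
* §2: `α^{(x+y).val} = α^{x.val} α^{y.val}`, `ξ α^{y.val} = α^{(u y).val} ξ`, the four product rules for the normal
  forms `α^x`, `α^x ξ`, injectivity, and `exists_normalForm` — every `g ∈ G` is `α^x` or `α^x ξ` (counting:
  `|G| = 4h = 2 · ord α`).

## References

* [Shimura1998] G. Shimura, *Abelian Varieties with Complex Multiplication and Modular Functions*, §8.2 (Galois
  groups of CM fields act through a model).

Provenance: Literature home (namespace `Literature.NumberTheory.ComplexMultiplication.GaloisSemidihedral`) of the Summits-side `CorCM/GaloisSemidihedralModularNormalForms` (cell `pub-hodgecm2`, COR-CM; all its imports are `Literature/`, Mathlib and the already re-homed `CyclicAsymmetricCMHalves`), which `Literature/` may not import; theorems only, no named fact, no definition. Nothing here bears on `HC_CM`. Lane `lit-hodgefound` (Layer A3: CM types, their Kubota ranks and Galois combinatorics), seat p20.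
-/

noncomputable section

namespace Literature.NumberTheory.ComplexMultiplication.GaloisSemidihedral

open Literature.NumberTheory.ComplexMultiplication.CyclicAsymmetricHalves

open Literature.NumberTheory.ComplexMultiplication.CyclicAsymmetricHalves

/-! ## §1 Arithmetic of `u = h ∓ 1` in `ℤ/2h` (`h` even) -/

section Arith

variable {h : ℕ}

/-- `h² = 0` in `ℤ/2h` for `h` even. [cite: Shimura1998, §8] -/
theorem natCast_h_mul_self (heven : Even h) : ((h : ℕ) : ZMod (2 * h)) * h = 0 := by
  obtain ⟨k, hk⟩ := heven
  have : ((h * h : ℕ) : ZMod (2 * h)) = 0 := by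
    rw [ZMod.natCast_eq_zero_iff]
    exact ⟨k, by rw [hk]; ring⟩
  exact_mod_cast this

/-- `-h = h` in `ℤ/2h`. [cite: Shimura1998, §8] -/
theorem neg_natCast_h : -((h : ℕ) : ZMod (2 * h)) = h := by
  have h2 : ((2 * h : ℕ) : ZMod (2 * h)) = 0 := ZMod.natCast_self _
  rw [neg_eq_iff_add_eq_zero, ← two_mul]
  exact_mod_cast h2

/-- **`u` is a unit and fixes `h`**: for `u₀ = h − 1` or `h + 1` (`h ≥ 1` even) there is `v` with `u v = 1`, and
`u h = h`. [cite: Shimura1998, §8] -/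
theorem unit_facts (heven : Even h) (h1 : 1 ≤ h) {u₀ : ℕ} (hu : u₀ = h - 1 ∨ u₀ = h + 1) :
    (∃ v : ZMod (2 * h), (u₀ : ZMod (2 * h)) * v = 1) ∧ (u₀ : ZMod (2 * h)) * h = h := by
  have hsq := natCast_h_mul_self heven
  have hneg := neg_natCast_h (h := h)
  rcases hu with rfl | rfl
  · have hcast : ((h - 1 : ℕ) : ZMod (2 * h)) = (h : ZMod (2 * h)) - 1 := by
      rw [Nat.cast_sub h1, Nat.cast_one]
    refine ⟨⟨-((h : ZMod (2 * h)) + 1), ?_⟩, ?_⟩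
    · rw [hcast]; linear_combination (-1 : ZMod (2 * h)) * hsq
    · rw [hcast, sub_mul, one_mul, hsq, zero_sub, hneg]
  · refine ⟨⟨-((h : ZMod (2 * h)) - 1), ?_⟩, ?_⟩
    · push_cast; linear_combination (-1 : ZMod (2 * h)) * hsq
    · push_cast; rw [add_mul, one_mul, hsq, zero_add]

/-- **`j ↦ u j` fixes exactly `0` and `h` among `{0, h}`**: `u j = 0 ↔ j = 0`, `u j = h ↔ j = h`. [cite: Shimura1998, §8] -/
theorem mul_eq_zero_iff_and_mul_eq_h_iff (heven : Even h) (h1 : 1 ≤ h) {u₀ : ℕ} (hu : u₀ = h - 1 ∨ u₀ = h + 1)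
    (j : ZMod (2 * h)) :
    ((u₀ : ZMod (2 * h)) * j = 0 ↔ j = 0) ∧ ((u₀ : ZMod (2 * h)) * j = h ↔ j = h) := by
  obtain ⟨⟨v, hv⟩, huh⟩ := unit_facts heven h1 hu
  have hvu : v * (u₀ : ZMod (2 * h)) = 1 := (mul_comm v _).trans hv
  refine ⟨⟨fun h0 => ?_, fun h0 => by rw [h0, mul_zero]⟩, ⟨fun hh => ?_, fun hh => by rw [hh, huh]⟩⟩
  · calc j = v * ((u₀ : ZMod (2 * h)) * j) := by rw [← mul_assoc, hvu, one_mul]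
      _ = 0 := by rw [h0, mul_zero]
  · have hvh : v * (h : ZMod (2 * h)) = h := by
      calc v * (h : ZMod (2 * h)) = v * ((u₀ : ZMod (2 * h)) * h) := by rw [huh]
        _ = h := by rw [← mul_assoc, hvu, one_mul]
    calc j = v * ((u₀ : ZMod (2 * h)) * j) := by rw [← mul_assoc, hvu, one_mul]
      _ = h := by rw [hh, hvh]

end Arith

/-! ## §2 Normal forms in a group with `ord α = 2h`, `ξ α = α^{u₀} ξ`, `ξ² = 1`, `ξ ∉ ⟨α⟩`, `|G| = 4h` -/

section Group

variable {G : Type*} [Group G] {α ξ : G} {h u₀ : ℕ}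

/-- `α^{(x+y).val} = α^{x.val} α^{y.val}`. [cite: Shimura1998, §8] -/
theorem pow_val_add [NeZero h] (hord : orderOf α = 2 * h) (x y : ZMod (2 * h)) :
    α ^ (x + y).val = α ^ x.val * α ^ y.val := by
  haveI : NeZero (2 * h) := ⟨by have := NeZero.ne h; omega⟩
  have key : ∀ n : ℕ, α ^ (n % (2 * h)) = α ^ n := fun n => by rw [← hord, pow_mod_orderOf]
  rw [← pow_add, ZMod.val_add, key]

/-- `ξ α^n = α^{u₀ n} ξ`. [cite: Shimura1998, §8] -/
theorem xi_mul_pow (hrel : ξ * α = α ^ u₀ * ξ) (n : ℕ) : ξ * α ^ n = α ^ (u₀ * n) * ξ := by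
  induction n with
  | zero => simp
  | succ n ih => rw [pow_succ, ← mul_assoc, ih, mul_assoc, hrel, ← mul_assoc, ← pow_add, Nat.mul_succ]

/-- `ξ α^{y.val} = α^{(u y).val} ξ`. [cite: Shimura1998, §8] -/
theorem xi_mul_pow_val [NeZero h] (hord : orderOf α = 2 * h) (hrel : ξ * α = α ^ u₀ * ξ) (y : ZMod (2 * h)) :
    ξ * α ^ y.val = α ^ ((u₀ : ZMod (2 * h)) * y).val * ξ := by
  haveI : NeZero (2 * h) := ⟨by have := NeZero.ne h; omega⟩
  have key : ∀ n : ℕ, α ^ (n % (2 * h)) = α ^ n := fun n => by rw [← hord, pow_mod_orderOf]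
  rw [xi_mul_pow hrel, ZMod.val_mul, ZMod.val_natCast, Nat.mod_mul_mod, key]

/-- Products in normal form: `(α^x ξ)(α^y) = α^{x + u y} ξ`. [cite: Shimura1998, §8] -/
theorem refl_mul_rot [NeZero h] (hord : orderOf α = 2 * h) (hrel : ξ * α = α ^ u₀ * ξ) (x y : ZMod (2 * h)) :
    (α ^ x.val * ξ) * α ^ y.val = α ^ (x + (u₀ : ZMod (2 * h)) * y).val * ξ := by
  rw [mul_assoc, xi_mul_pow_val hord hrel, ← mul_assoc, ← pow_val_add hord]

/-- `(α^x ξ)(α^y ξ) = α^{x + u y}`. [cite: Shimura1998, §8] -/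
theorem refl_mul_refl [NeZero h] (hord : orderOf α = 2 * h) (hrel : ξ * α = α ^ u₀ * ξ) (hξ2 : ξ * ξ = 1)
    (x y : ZMod (2 * h)) : (α ^ x.val * ξ) * (α ^ y.val * ξ) = α ^ (x + (u₀ : ZMod (2 * h)) * y).val := by
  rw [← mul_assoc, refl_mul_rot hord hrel, mul_assoc, hξ2, mul_one]

/-- `α^x (α^y ξ) = α^{x+y} ξ`. [cite: Shimura1998, §8] -/
theorem rot_mul_refl [NeZero h] (hord : orderOf α = 2 * h) (x y : ZMod (2 * h)) :
    α ^ x.val * (α ^ y.val * ξ) = α ^ (x + y).val * ξ := by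
  rw [← mul_assoc, ← pow_val_add hord]

/-- `α^{x.val} = α^{y.val} ↔ x = y`. [cite: Shimura1998, §8] -/
theorem pow_val_inj [NeZero h] (hord : orderOf α = 2 * h) {x y : ZMod (2 * h)} :
    α ^ x.val = α ^ y.val ↔ x = y := by
  haveI : NeZero (2 * h) := ⟨by have := NeZero.ne h; omega⟩
  constructor
  · intro hxy
    have hx : x.val ∈ Set.Iio (orderOf α) := by rw [hord]; exact x.val_lt
    have hy : y.val ∈ Set.Iio (orderOf α) := by rw [hord]; exact y.val_lt
    exact ZMod.val_injective _ (pow_injOn_Iio_orderOf hx hy hxy)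
  · rintro rfl; rfl

/-- `α^{x.val} ≠ α^{y.val} ξ` when `ξ ∉ ⟨α⟩`. [cite: Shimura1998, §8] -/
theorem pow_val_ne_pow_val_mul (hξ : ξ ∉ Subgroup.zpowers α) (x y : ZMod (2 * h)) :
    α ^ x.val ≠ α ^ y.val * ξ := by
  intro heq
  apply hξ
  have : ξ = (α ^ y.val)⁻¹ * α ^ x.val := by rw [heq, inv_mul_cancel_left]
  rw [this]
  exact Subgroup.mul_mem _ (Subgroup.inv_mem _ (Subgroup.pow_mem _ (Subgroup.mem_zpowers α) _))
    (Subgroup.pow_mem _ (Subgroup.mem_zpowers α) _)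

/-- **Every element is `α^x` or `α^x ξ`** (`|G| = 4h = 2 · ord α`, `ξ ∉ ⟨α⟩`). [cite: Shimura1998, §8] -/
theorem exists_normalForm [Fintype G] [NeZero h] (hord : orderOf α = 2 * h) (hξ : ξ ∉ Subgroup.zpowers α)
    (hcard : Fintype.card G = 4 * h) (g : G) : ∃ x : ZMod (2 * h), g = α ^ x.val ∨ g = α ^ x.val * ξ := by
  classical
  haveI : NeZero (2 * h) := ⟨by have := NeZero.ne h; omega⟩
  let f : ZMod (2 * h) ⊕ ZMod (2 * h) → G := fun s => Sum.elim (fun x => α ^ x.val) (fun x => α ^ x.val * ξ) s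
  have hinj : Function.Injective f := by
    rintro (x | x) (y | y) hxy
    · exact congrArg Sum.inl ((pow_val_inj hord).1 hxy)
    · exact absurd hxy (pow_val_ne_pow_val_mul hξ x y)
    · exact absurd hxy.symm (pow_val_ne_pow_val_mul hξ y x)
    · exact congrArg Sum.inr ((pow_val_inj hord).1 (mul_right_cancel hxy))
  have hbij : Function.Bijective f := by
    rw [Fintype.bijective_iff_injective_and_card]
    exact ⟨hinj, by rw [Fintype.card_sum, ZMod.card, hcard]; ring⟩
  obtain ⟨s, hs⟩ := hbij.2 g
  rcases s with x | x
  · exact ⟨x, Or.inl hs.symm⟩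
  · exact ⟨x, Or.inr hs.symm⟩

end Group

end Literature.NumberTheory.ComplexMultiplication.GaloisSemidihedral

end
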